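import Summits.BirchSwinnertonDyer.BirchSwinnertonDyer.Theorems.PrintX10bControlCompactGlue
import Literature.NumberTheory.EllipticCurves.ZpExtensionEisensteinPinnedTorsionFreeProofs
import Literature.NumberTheory.EllipticCurves.LambdaAdicSelmerDataTorsionFreeProofs
import HarnessLib

/-!
# The bottom class `κ₁^{(𝔮_m)} = f_m(z)` of the specialised Kolyvagin system is NON-ZERO for every `m ≫ 0`, WITHOUT
# Theorem 1.6.1 and without a control kernel (helper for the shared μ-crux `MuInequalityCoherentPairOfHoward`,
# stmt-BirchSwinnertonDyer-23088 — the conjunct `κKS.one ≠ 0` of `stub_howardInputs` for a Kolyvagin system whose bottom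
# class is the control image `ctrlLevel … z`; crux of record of this seat `PrintX10b.BeyondCarrierDepthX10b`, stmt-23055)

Summits-side helper; THEOREMS ONLY, no named fact, no `sorry`. Cell `pub/bsd-print-x9`, seat `bsd-line-x10b-p1-w2` g9
(C8); companion of `Literature/NumberTheory/EllipticCurves/ZpExtensionEisensteinPinnedTorsionFreeProofs` (the pinned
`H¹(K, T_𝔮)` is `S_𝔮`-torsion-free when `H⁰(K, T_𝔮/p) = 0`) and of `PrintX10bControlCokernelUniform` (p656163: ONE
`e ∈ 𝔖 = 𝔖_p(K_∞)` and ONE `n₁` with `f_m e ∉ T^{p^{n₁}} • H¹(K, T_{𝔮_m})` for every `m ≥ p^{n₁}`, every `t, ht, I`).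

WHAT. For `V/K` elliptic, `E(K)[p] = 0` (`hE`), `γ` a topological generator, `𝔖 = D.S` finitely generated:
* `torsionGaloisModule_one_eq_zero_of_forall` — `H⁰(K, E[p]) = 0` in the form the generic file consumes (from `hE` via
  `LambdaAdicSelmerData.noPTorsion_layer` at layer `0`);
* `toEisensteinH1Linear_eq_zero_of_smul_eq_zero_of_mk_ne_zero` — the pin of `H¹(K, T_{𝔮_m})` (sign `κ⁻ = κ.unitTwist (-1)`,
  ANY transition datum `t, ht`, ANY pin `I`) is `S_{𝔮_m}`-torsion-free on control images: `g • f_m s = 0`, `q_m ∤ g` ⇒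
  `f_m s = 0` (in fact on all of `I.H`: `EisensteinH1Data.eq_zero_of_smul_eq_zero_of_mk_ne_zero`);
* **`exists_forall_toEisensteinH1Linear_ne_zero`** — for `z ∈ 𝔖`, `z ≠ 0`, with `𝔖/Λz` torsion (the letter's
  `stabilizedHeegnerModule D C = Λ z`, `Module.IsTorsion Λ (𝔖 ⧸ Λ z)`): **∃ `n₁ m₂`, ∀ `m` with `p^{n₁} ≤ m`, `m₂ ≤ m`,
  ∀ `t ht I`: `f_m z = toEisensteinH1Linear … z ≠ 0`** — hence `ctrlLevel … z ≠ 0`, i.e. the input `κ₁ ≠ 0` of Howard's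
  Thm. 1.6.1 for the pushed-forward Kolyvagin system, for all `m ≫ 0`, constants chosen BEFORE `m`.
HONEST FRAMING: this does not construct the Kolyvagin system nor identify its bottom class with the control image (that
is (F-411) + the `Hom` of the D1/x9-p2 lineages); no summit statement is proved; BSD is not proved by any of this.

References: B. Howard, Compositio Math. 140 (2004) = arXiv:1202.6340, Lemma 2.2.9 and proof of Thm. 2.2.10 (arXiv 3.2.9,
3.2.10 p. 17 L60–92: «κ₁^{(𝔭)} generates an infinite S_𝔭-submodule for all but finitely many 𝔭»); R. Greenberg, LNM 1716
(1999) §4 p. 109; J. Silverman, AEC (2009), Cor. III.6.4.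
-/

set_option linter.dupNamespace false
set_option autoImplicit false

noncomputable section

open scoped TensorProduct ContRepresentation Classical

namespace Summit.BirchSwinnertonDyer.BirchSwinnertonDyer.Theorems.PrintX10bCompactControl

open WeierstrassCurve Literature.NumberTheory.EllipticCurves Literature.NumberTheory.GaloisRepresentations IsDedekindDomain
open Literature.NumberTheory.EllipticCurves.ZpExtension Literature.NumberTheory.GaloisCohomology.Howard2004
open scoped NumberField

variable {K : Type} [Field K] [NumberField K] {V : WeierstrassCurve K} [V.IsElliptic] {p : ℕ} [hp : Fact p.Prime]
  {κ : ZpExtension K p} {γ : Field.absoluteGaloisGroup K}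

/-- **`H⁰(K, E[p]) = 0` from `E(K)[p] = 0`**, in the currency of the torsion-freeness file: a point of `E[p](K̄)` fixed by
`Γ_K` is `0`. [cite: GreenbergLNM1716, §4 p. 109 (E(F_∞)[p] = 0 when E(F)[p] = 0)] [cite: SilvermanAEC2009, Cor. III.6.4] -/
theorem torsionGaloisModule_one_eq_zero_of_forall (κ : ZpExtension K p)
    (hE : ∀ P : V.toAffine.Point, p • P = 0 → P = 0) (a : geomTorsion V ((p : ℤ) ^ 1))
    (ha : ∀ σ : Field.absoluteGaloisGroup K, V.torsionGaloisModule ((p : ℤ) ^ 1) σ a = a) : a = 0 := by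
  apply Subtype.ext
  refine LambdaAdicSelmerData.noPTorsion_layer κ hE 0 (a : geomPoints V) (fun σ _ ↦ ?_) ?_
  · have h := congrArg Subtype.val (ha σ)
    rwa [torsionGaloisModule_apply_apply, Literature.NumberTheory.EllipticCurves.AddSubgroup.torsionBy.coe_smul] at h
  · have h := (mem_geomTorsion_iff V _ _).1 a.2
    simpa only [pow_one] using h

omit [NumberField K] in
/-- The hypotheses `ht`, `hkt`, `hkill` of the two-index family for the curve's tower along any lifts `t` of `P ↦ p • P`
(`torsionGaloisModule_transition_hypotheses`, repackaged from the skeleton's binder `ht`).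
[cite: SilvermanAEC2009, §VIII.2 and Cor. III.6.4] -/
theorem transition_hypotheses_of_ht
    (t : ∀ k, (V.torsionGaloisModule ((p : ℤ) ^ (k + 1))).toContRepresentation →ⁱL
      (V.torsionGaloisModule ((p : ℤ) ^ k)).toContRepresentation)
    (ht : ∀ k (P : geomTorsion V ((p : ℤ) ^ (k + 1))), t k P = V.geomTorsionReduce p k P) :
    (∀ k, Function.Surjective (t k)) ∧
      (∀ k (x : geomTorsion V ((p : ℤ) ^ (k + 1))), t k x = 0 ↔
        ∃ y : geomTorsion V ((p : ℤ) ^ (k + 1)), x = ((p : ℤ) ^ k) • y) ∧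
      ∀ k (x : geomTorsion V ((p : ℤ) ^ k)), ((p : ℤ) ^ k) • x = 0 :=
  V.torsionGaloisModule_transition_hypotheses t fun k P ↦ by rw [ht k P]; exact V.coe_geomTorsionReduce p k P

/-- **The pin of `H¹(K, T_{𝔮_m})` is `S_{𝔮_m}`-torsion-free** (`E(K)[p] = 0`): `g • h = 0` with `q_m ∤ g` forces `h = 0`,
for ANY transition datum `t, ht` and ANY pin `I` (sign `κ⁻ = κ.unitTwist (-1)`).
[cite: Howard2004HeegnerKolyvagin, Lemma 2.2.9 and proof of Thm. 2.2.10] [cite: GreenbergLNM1716, §4 p. 109] -/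
theorem eisensteinH1Data_eq_zero_of_smul_eq_zero_of_mk_ne_zero (κ : ZpExtension K p)
    (hE : ∀ P : V.toAffine.Point, p • P = 0 → P = 0) {m : ℕ} (hm : 1 ≤ m)
    [IsDomain (IwasawaAlgebra p ⧸
      Ideal.span {(PowerSeries.X ^ m + PowerSeries.C (p : ℤ_[p]) : IwasawaAlgebra p)})]
    [IsDiscreteValuationRing (IwasawaAlgebra p ⧸
      Ideal.span {(PowerSeries.X ^ m + PowerSeries.C (p : ℤ_[p]) : IwasawaAlgebra p)})]
    (t : ∀ k, (V.torsionGaloisModule ((p : ℤ) ^ (k + 1))).toContRepresentation →ⁱL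
      (V.torsionGaloisModule ((p : ℤ) ^ k)).toContRepresentation)
    (ht : ∀ k (P : geomTorsion V ((p : ℤ) ^ (k + 1))), t k P = V.geomTorsionReduce p k P)
    (I : ZpExtension.EisensteinH1Data (κ.unitTwist (-1)) (fun k ↦ V.torsionGaloisModule ((p : ℤ) ^ k)) t hm)
    (g : IwasawaAlgebra p)
    (hg : Ideal.Quotient.mk
      (Ideal.span {(PowerSeries.X ^ m + PowerSeries.C (p : ℤ_[p]) : IwasawaAlgebra p)}) g ≠ 0)
    (h : I.H) (hh : g • h = 0) : h = 0 := by
  have hpK : (p : K) ≠ 0 := Nat.cast_ne_zero.2 hp.out.ne_zero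
  obtain ⟨hsurj, hkt, hkill⟩ := transition_hypotheses_of_ht t ht
  exact I.eq_zero_of_smul_eq_zero_of_mk_ne_zero hsurj hkt hkill
    (fun k ↦ (V.nonempty_geomTorsion_prime_pow_addEquiv_fin_two hpK k).some)
    (torsionGaloisModule_one_eq_zero_of_forall κ hE) g hg h hh

/-- **`κ₁^{(𝔮_m)} ≠ 0` for all `m ≫ 0`.** For `E(K)[p] = 0`, `γ` a topological generator, `𝔖` finitely generated and
`z ∈ 𝔖` non-zero with `𝔖/Λz` torsion, there are `n₁, m₂` such that for every `m` with `p^{n₁} ≤ m` and `m₂ ≤ m`, every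
transition datum `t, ht` and every pin `I` of `H¹(K, T_{𝔮_m})`: `f_m z = toEisensteinH1Linear … z ≠ 0` — ONE
`e ∈ 𝔖 ∖ p𝔖` has `f_m e ∉ T^{p^{n₁}} • H¹(K, T_{𝔮_m})` (p656163), `g • e ∈ Λ z` with `g ≠ 0`, `[g]_m ≠ 0` for
`m ≥ m₂`, and `H¹(K, T_{𝔮_m})` is `S_{𝔮_m}`-torsion-free. No Theorem 1.6.1, no control kernel.
[cite: Howard2004HeegnerKolyvagin, proof of Thm. 2.2.10 (arXiv 3.2.10, p. 17 L90–92) and Lemma 2.2.9] -/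
theorem exists_forall_toEisensteinH1Linear_ne_zero (D : V.LambdaAdicSelmerData κ γ)
    [Module.Finite (IwasawaAlgebra p) D.S] (hγ : κ.IsTopGenerator γ)
    (hE : ∀ P : V.toAffine.Point, p • P = 0 → P = 0) (z : D.S) (hz : z ≠ 0)
    (htor : Module.IsTorsion (IwasawaAlgebra p) (D.S ⧸ (IwasawaAlgebra p) ∙ z)) :
    ∃ n₁ m₂ : ℕ, ∀ {m : ℕ} (hm : 1 ≤ m)
      (t : ∀ k, (V.torsionGaloisModule ((p : ℤ) ^ (k + 1))).toContRepresentation →ⁱL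
        (V.torsionGaloisModule ((p : ℤ) ^ k)).toContRepresentation)
      (ht : ∀ k (P : geomTorsion V ((p : ℤ) ^ (k + 1))), t k P = V.geomTorsionReduce p k P)
      (I : ZpExtension.EisensteinH1Data (κ.unitTwist (-1)) (fun k ↦ V.torsionGaloisModule ((p : ℤ) ^ k)) t hm),
      p ^ n₁ ≤ m → m₂ ≤ m → D.toEisensteinH1Linear hm t ht I hγ hE z ≠ 0 := by
  obtain ⟨e, n₁, hen₁⟩ :=
    PrintX10bModPDivision.exists_forall_toEisensteinH1Linear_not_mem_X_pow_smul_top D hγ hE ⟨z, hz⟩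
  obtain ⟨g, hg0, hge⟩ := exists_ne_zero_and_smul_mem_span z htor e
  obtain ⟨m₂, hm₂⟩ := IwasawaAlgebra.exists_forall_mk_ne_zero p hg0
  refine ⟨n₁, m₂, fun hm t ht I hn₁m hm₂m ↦ ?_⟩
  haveI := IwasawaAlgebra.isDomain_quotient_X_pow_add_C p hm
  haveI := IwasawaAlgebra.isDiscreteValuationRing_quotient_X_pow_add_C p hm
  have hpK : (p : K) ≠ 0 := Nat.cast_ne_zero.2 hp.out.ne_zero
  obtain ⟨hsurj, hkt, hkill⟩ := transition_hypotheses_of_ht t ht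
  exact I.apply_ne_zero_of_not_mem_of_smul_mem_span hsurj hkt hkill
    (fun k ↦ (V.nonempty_geomTorsion_prime_pow_addEquiv_fin_two hpK k).some)
    (torsionGaloisModule_one_eq_zero_of_forall κ hE) (D.toEisensteinH1Linear hm t ht I hγ hE) e
    (hen₁ hm t ht I hn₁m) z g (hm₂ _ hm₂m) hge

end Summit.BirchSwinnertonDyer.BirchSwinnertonDyer.Theorems.PrintX10bCompactControl

end
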